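import Summits.CriticalPhenomena.PercolationContinuityZ3.Theorems.PercNearOneGluingNoHeavyLowerTailStarSetForestCertificateTools
import HarnessLib

/-!
# `NoHeavyLowerTail` (stmt-CriticalPhenomena-4575) — pattern sums pushed forward to PARALLEL CLASSES (algebra)

Support file (prover `prim-gen-swap` gen 8; `--supports stmt-CriticalPhenomena-4575`).  No definitions, no named facts, no sorries;
Mathlib only (plus the cylinder sums of …StarSetForestCertificateTools).

Two-port stars `i ∈ ι` open independently with probability `θ_i` (pattern weights `W(σ) = Π_{i∈σ}θ_i Π_{i∉σ}(1−θ_i)`); `cls : ι → κ`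
sends a star to its PARALLEL CLASS (stars with the same port pair).  Every quantity of the level-two star-set programme (seat memo
CYCLES-CERT.md §1) depends on the pattern `σ` only through the set of open classes `σ.image cls`, and the image of the pattern law is
the pattern law of the classes with `Θ_I = 1 − Π_{cls i = I}(1 − θ_i)`:

* `StarSet.classPattern_fibre` — `Σ_σ W(σ)·[σ.image cls = S] = Π_{I∈S}(1 − u_I)·Π_{I∉S} u_I`, `u_I = Π_{cls i = I}(1 − θ_i)`;
* `StarSet.linkSum_pushforward` — `Σ_σ W(σ) F(σ.image cls) = Σ_S (Π_{I∈S}(1 − u_I) Π_{I∉S} u_I) F(S)`.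
-/

namespace Summit.CriticalPhenomena.PercolationContinuityZ3.Theorems

open Finset
open scoped BigOperators

namespace StarSet

variable {ι κ : Type*} [Fintype ι] [DecidableEq ι] [Fintype κ] [DecidableEq κ]

omit [Fintype κ] in
/-- Indicator algebra: `[σ.image cls = S] = [∀ i ∈ σ, cls i ∈ S] · Π_{I∈S} (1 − [no star of class I in σ])`. [folklore] -/
theorem image_eq_indicator (cls : ι → κ) (σ : Finset ι) (S : Finset κ) :
    (if σ.image cls = S then (1 : ℝ) else 0) =
      (if (∀ i ∈ σ, cls i ∈ S) then (1 : ℝ) else 0) *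
        ∏ I ∈ S, (1 - (if (∀ i, cls i = I → i ∉ σ) then (1 : ℝ) else 0)) := by
  have hfac : ∀ I, (1 - (if (∀ i, cls i = I → i ∉ σ) then (1 : ℝ) else 0)) =
      (if (∃ i ∈ σ, cls i = I) then (1 : ℝ) else 0) := by
    intro I
    by_cases h : ∃ i ∈ σ, cls i = I
    · rw [if_pos h, if_neg, sub_zero]
      obtain ⟨i, hi, hci⟩ := h
      exact fun hall => hall i hci hi
    · rw [if_neg h, if_pos, sub_self]
      intro i hci hi
      exact h ⟨i, hi, hci⟩
  simp_rw [hfac]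
  rw [prod_boole]
  by_cases h : σ.image cls = S
  · rw [if_pos h, if_pos, if_pos, mul_one]
    · intro I hI
      rw [← h] at hI
      obtain ⟨i, hi, rfl⟩ := mem_image.1 hI
      exact ⟨i, hi, rfl⟩
    · intro i hi
      rw [← h]
      exact mem_image_of_mem cls hi
  · rw [if_neg h]
    by_cases h1 : ∀ i ∈ σ, cls i ∈ S
    · rw [if_pos h1, one_mul, if_neg]
      intro h2
      apply h
      ext I
      constructor
      · intro hI
        obtain ⟨i, hi, rfl⟩ := mem_image.1 hI
        exact h1 i hi
      · intro hI
        obtain ⟨i, hi, hci⟩ := h2 I hI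
        exact mem_image.2 ⟨i, hi, hci⟩
    · rw [if_neg h1, zero_mul]

/-- **Fibre mass of the class map.**  `Σ_σ W(σ)·[σ.image cls = S] = Π_{I∈S}(1 − u_I)·Π_{I∉S} u_I` with
`u_I = Π_{cls i = I}(1 − θ_i)`. [folklore] -/
theorem classPattern_fibre (θ : ι → ℝ) (cls : ι → κ) (S : Finset κ) :
    ∑ σ ∈ (univ : Finset ι).powerset, ((∏ i ∈ σ, θ i) * ∏ i ∈ univ \ σ, (1 - θ i)) *
        (if σ.image cls = S then (1 : ℝ) else 0) =
      (∏ I ∈ S, (1 - ∏ i ∈ univ.filter (fun i => cls i = I), (1 - θ i))) *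
        ∏ I ∈ univ \ S, ∏ i ∈ univ.filter (fun i => cls i = I), (1 - θ i) := by
  set W : Finset ι → ℝ := fun σ => (∏ i ∈ σ, θ i) * ∏ i ∈ univ \ σ, (1 - θ i) with hW
  set u : κ → ℝ := fun I => ∏ i ∈ univ.filter (fun i => cls i = I), (1 - θ i) with hu
  set e : κ → Finset ι → ℝ := fun I σ => if (∀ i, cls i = I → i ∉ σ) then (1 : ℝ) else 0 with he
  -- expand the product `Π_{I∈S}(1 − e_I σ) = Σ_{T ⊆ S} Π_{I∈T} (−e_I σ)`
  have hexp : ∀ σ : Finset ι, ∏ I ∈ S, (1 - e I σ) = ∑ T ∈ S.powerset, ∏ I ∈ T, (- e I σ) := by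
    intro σ
    rw [← prod_one_add]
    exact prod_congr rfl fun I _ => by ring
  -- the cylinder behind `[σ ⊆ cls⁻¹ S]·Π_{I∈T} e_I σ`
  have hcyl : ∀ T ∈ S.powerset, ∀ σ : Finset ι,
      (if (∀ i ∈ σ, cls i ∈ S) then (1 : ℝ) else 0) * ∏ I ∈ T, (- e I σ) =
        (∏ I ∈ T, (-1 : ℝ)) *
          (if (∀ k ∈ univ.filter (fun k => cls k ∉ S ∨ cls k ∈ T), k ∉ σ) then (1 : ℝ) else 0) := by
    intro T hT σ
    have hneg : ∏ I ∈ T, (- e I σ) = (∏ I ∈ T, (-1 : ℝ)) * ∏ I ∈ T, e I σ := by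
      rw [← prod_mul_distrib]
      exact prod_congr rfl fun I _ => by ring
    rw [hneg, he]
    simp only
    rw [prod_boole, mul_left_comm]
    congr 1
    by_cases h : ∀ k ∈ univ.filter (fun k => cls k ∉ S ∨ cls k ∈ T), k ∉ σ
    · rw [if_pos h, if_pos, if_pos, mul_one]
      · intro I hI i hci hi
        exact h i (mem_filter.2 ⟨mem_univ _, Or.inr (hci ▸ hI)⟩) hi
      · intro i hi
        by_contra hniS
        exact h i (mem_filter.2 ⟨mem_univ _, Or.inl hniS⟩) hi
    · rw [if_neg h]
      push Not at h
      obtain ⟨k, hk, hkσ⟩ := h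
      rcases (mem_filter.1 hk).2 with hkS | hkT
      · rw [if_neg (fun hall => hkS (hall k hkσ)), zero_mul]
      · by_cases h1 : ∀ i ∈ σ, cls i ∈ S
        · rw [if_pos h1, one_mul, if_neg]
          intro hall
          exact hall (cls k) hkT k rfl hkσ
        · rw [if_neg h1, zero_mul]
  -- the closed cylinder's mass in terms of the class products `u`
  have hmass : ∀ T ∈ S.powerset,
      ∏ k ∈ univ.filter (fun k => cls k ∉ S ∨ cls k ∈ T), (1 - θ k) = (∏ I ∈ univ \ S, u I) * ∏ I ∈ T, u I := by
    intro T hT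
    have hTS : T ⊆ S := mem_powerset.1 hT
    have hset : univ.filter (fun k => cls k ∉ S ∨ cls k ∈ T) = univ.filter (fun k => cls k ∈ (univ \ S) ∪ T) := by
      ext k
      simp only [mem_filter, mem_univ, true_and, mem_union, mem_sdiff]
    rw [hset, ← prod_fiberwise_eq_prod_filter univ ((univ \ S) ∪ T) cls (fun k => 1 - θ k),
      prod_union (disjoint_sdiff_self_left.mono_right hTS)]
  -- assemble
  calc ∑ σ ∈ (univ : Finset ι).powerset, W σ * (if σ.image cls = S then (1 : ℝ) else 0)
      = ∑ σ ∈ (univ : Finset ι).powerset, ∑ T ∈ S.powerset,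
          (∏ I ∈ T, (-1 : ℝ)) * (W σ *
            (if (∀ k ∈ univ.filter (fun k => cls k ∉ S ∨ cls k ∈ T), k ∉ σ) then (1 : ℝ) else 0)) := by
        refine sum_congr rfl fun σ _ => ?_
        rw [image_eq_indicator cls σ S, hexp σ, mul_sum, mul_sum]
        refine sum_congr rfl fun T hT => ?_
        have h := hcyl T hT σ
        calc W σ * ((if (∀ i ∈ σ, cls i ∈ S) then (1 : ℝ) else 0) * ∏ I ∈ T, (- e I σ))
            = W σ * ((∏ I ∈ T, (-1 : ℝ)) *
                (if (∀ k ∈ univ.filter (fun k => cls k ∉ S ∨ cls k ∈ T), k ∉ σ) then (1 : ℝ) else 0)) := by rw [h]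
          _ = _ := by ring
    _ = ∑ T ∈ S.powerset, (∏ I ∈ T, (-1 : ℝ)) *
          ∑ σ ∈ (univ : Finset ι).powerset, W σ *
            (if (∀ k ∈ univ.filter (fun k => cls k ∉ S ∨ cls k ∈ T), k ∉ σ) then (1 : ℝ) else 0) := by
        rw [sum_comm]
        exact sum_congr rfl fun T _ => by rw [mul_sum]
    _ = ∑ T ∈ S.powerset, (∏ I ∈ T, (-1 : ℝ)) * ((∏ I ∈ univ \ S, u I) * ∏ I ∈ T, u I) := by
        refine sum_congr rfl fun T hT => ?_
        rw [hW, cylinder_sum_closed θ _, hmass T hT]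
    _ = (∏ I ∈ univ \ S, u I) * ∑ T ∈ S.powerset, ∏ I ∈ T, (- u I) := by
        rw [mul_sum]
        refine sum_congr rfl fun T _ => ?_
        have : ∏ I ∈ T, (- u I) = (∏ I ∈ T, (-1 : ℝ)) * ∏ I ∈ T, u I := by
          rw [← prod_mul_distrib]
          exact prod_congr rfl fun I _ => by ring
        rw [this]
        ring
    _ = (∏ I ∈ S, (1 - u I)) * ∏ I ∈ univ \ S, u I := by
        rw [← prod_one_add, mul_comm]
        exact congrArg₂ (· * ·) (prod_congr rfl fun I _ => by ring) rfl

/-- **Push-forward of a pattern sum to the parallel classes.**  For every `F`: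
`Σ_σ W(σ)·F(σ.image cls) = Σ_S (Π_{I∈S}(1 − u_I)·Π_{I∉S} u_I)·F(S)`, `u_I = Π_{cls i = I}(1 − θ_i)`. [folklore] -/
theorem linkSum_pushforward (θ : ι → ℝ) (cls : ι → κ) (F : Finset κ → ℝ) :
    ∑ σ ∈ (univ : Finset ι).powerset, ((∏ i ∈ σ, θ i) * ∏ i ∈ univ \ σ, (1 - θ i)) * F (σ.image cls) =
      ∑ S ∈ (univ : Finset κ).powerset,
        ((∏ I ∈ S, (1 - ∏ i ∈ univ.filter (fun i => cls i = I), (1 - θ i))) *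
            ∏ I ∈ univ \ S, ∏ i ∈ univ.filter (fun i => cls i = I), (1 - θ i)) * F S := by
  have hF : ∀ σ : Finset ι, F (σ.image cls) =
      ∑ S ∈ (univ : Finset κ).powerset, (if σ.image cls = S then (1 : ℝ) else 0) * F S := by
    intro σ
    simp_rw [boole_mul]
    rw [sum_ite_eq, if_pos (mem_powerset.2 (subset_univ _))]
  have h1 : ∑ σ ∈ (univ : Finset ι).powerset, ((∏ i ∈ σ, θ i) * ∏ i ∈ univ \ σ, (1 - θ i)) * F (σ.image cls) =
      ∑ σ ∈ (univ : Finset ι).powerset, ∑ S ∈ (univ : Finset κ).powerset,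
        (((∏ i ∈ σ, θ i) * ∏ i ∈ univ \ σ, (1 - θ i)) * (if σ.image cls = S then (1 : ℝ) else 0)) * F S := by
    refine sum_congr rfl fun σ _ => ?_
    rw [hF σ, mul_sum]
    exact sum_congr rfl fun S _ => by ring
  rw [h1, sum_comm]
  refine sum_congr rfl fun S _ => ?_
  rw [← sum_mul, classPattern_fibre θ cls S]

end StarSet

end Summit.CriticalPhenomena.PercolationContinuityZ3.Theorems
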